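import Literature.Analysis.FunctionSpaces.UniformRandomWalkDensityFour
import Literature.Analysis.FunctionSpaces.UniformRandomWalkMoments
import Literature.Combinatorics.Enumerative.DombNumbers
import Literature.Analysis.Complex.CarlsonTheorem
import Mathlib.Analysis.MellinTransform
import HarnessLib

/-!
# The moment function `W₄(s)` of the four-step uniform random walk and its functional equation

For the planar uniform random walk `S₄` (four unit steps in uniformly random directions) the
moments of the distance are `W₄(s) = ∫₀⁴ x^s p₄(x) dx`, where `p₄` is the density of `|S₄|`
(Kluyver; `Literature/Analysis/FunctionSpaces/UniformRandomWalkDensityFour.lean`). Borwein, Straub,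
Wan and Zudilin [BorweinEtAl2012, §2, Example 1] record the functional equation

  `(s+4)³ W₄(s+4) − 4(s+3)(5s²+30s+48) W₄(s+2) + 64(s+2)³ W₄(s) = 0`,

"coming from the inevitable recursion that exists for" the even moments `W₄(2k)` (the Domb
numbers) and lifted to complex `s` by Carlson's theorem ([BorweinEtAl2012, §2, before Example 1];
originally Borwein–Nuyens–Straub–Wan). This file PROVES it, for `Re s > −3/2`:

* `Literature.Analysis.FunctionSpaces.pFour` — the density `p₄(x) = 2πx f₄(x) = x∫₀^∞ tJ₀(xt)J₀(t)⁴dt`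
  of `|S₄|` as a function on `ℝ`; `≥ 0`, continuous on `(0,∞)`, `p₄(x) ≤ K√x`, vanishing for
  `x > 4`, total mass `1`, and `∫ g(‖z‖) dS₄ = ∫₀^∞ p₄(x) g(x) dx`;
* `Literature.Analysis.FunctionSpaces.W4` — `W₄(s) = ∫₀^∞ x^s p₄(x) dx` (a Mellin transform),
  holomorphic on `Re s > −3/2`, `|W₄(s)| ≤ 4^{Re s}` for `Re s ≥ 0`, and `W₄(2k) = D_k`
  (`W4_two_mul_natCast`, from `integral_norm_pow_four`);
* `Literature.Analysis.FunctionSpaces.W4_functionalEquation` — the functional equation above.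

## Proof (as in the source)

At `s = 2k` the functional equation is `8×` the Domb recurrence
`(k+2)³D_{k+2} − 2(2k+3)(5k²+15k+12)D_{k+1} + 64(k+1)³D_k = 0`
(`Literature.Combinatorics.Enumerative.domb_recurrence`). The function
`u ↦ 4^{−(2u+4)} (u+1)^{−3} · [FE at s = 2u]` is holomorphic on `Re u > −3/4`, bounded on
`Re u ≥ 0` (by `|W₄(s)| ≤ 4^{Re s}`) and vanishes at `u = 0, 1, 2, …`; by Carlson's theorem
(`Literature.Analysis.Complex.AndrewsAskeyRoy1999_thm_2_8_1_holds`) it vanishes for `Re u ≥ 0`,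
i.e. the functional equation holds for `Re s ≥ 0`, and then on the half-plane of holomorphy
`Re s > −3/2` by the identity theorem.

## References

* [BorweinEtAl2012] J. M. Borwein, A. Straub, J. Wan, W. Zudilin, *Densities of short uniform
  random walks*, Canad. J. Math. 64 (2012) 961–990 (arXiv:1103.2995), §2: eq. (2.1), the moments
  `W_n(s)`, and Example 1 (functional equation of `W₄`).
* J. M. Borwein, D. Nuyens, A. Straub, J. Wan, *Some arithmetic properties of short random walk
  integrals*, Ramanujan J. 26 (2011) 109–132 (the recursions and Carlson's theorem).
-/

noncomputable section

open _root_.MeasureTheory _root_.Set _root_.Real _root_.Complex _root_.Filter _root_.Asymptotics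
open scoped ENNReal Topology Nat
open Literature.Probability.Distributions Literature.Combinatorics.Enumerative
open Literature.Analysis.Complex

namespace Literature.Analysis.FunctionSpaces

/-! ### The density `p₄` of `|S₄|` -/

/-- **The density of `|S₄|`**: `p₄(x) = 2πx f₄(x) = x ∫₀^∞ t J₀(xt) J₀(t)⁴ dt` (Kluyver), as a
function on `ℝ` (the relevant values are `x > 0`). [cite: BorweinEtAl2012, §2 eq. (2.1)] -/
def pFour (x : ℝ) : ℝ := 2 * π * x * hankelDensity (fun r => besselJ 0 r ^ 4) x

/-- The law of `|S₄|` is `p₄(x) dx` on `(0, ∞)`. [cite: BorweinEtAl2012, §2 eq. (2.1)] -/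
theorem map_norm_uniformWalkLaw_four_eq_pFour :
    (uniformWalkLaw 4).map (fun z : ℂ => ‖z‖) =
      (volume.restrict (Ioi (0 : ℝ))).withDensity (fun x => ENNReal.ofReal (pFour x)) :=
  map_norm_uniformWalkLaw_four

/-- `p₄ ≥ 0` on `[0, ∞)`. [folklore] -/
theorem pFour_nonneg {x : ℝ} (hx : 0 ≤ x) : 0 ≤ pFour x := by
  rcases hx.eq_or_lt with h | h
  · rw [← h]; simp [pFour]
  · have h0 : (x : ℂ) ≠ 0 := by exact_mod_cast h.ne'
    have := fourStepDensity_nonneg h0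
    unfold pFour
    exact mul_nonneg (by positivity) this

/-- `p₄` is continuous on `(0, ∞)`. [folklore] -/
theorem continuousOn_pFour : ContinuousOn pFour (Ioi 0) := by
  have h1 : ContinuousOn (fun x : ℝ => hankelDensity (fun r => besselJ 0 r ^ 4) (x : ℂ)) (Ioi 0) :=
    continuousOn_fourStepDensity.comp continuous_ofReal.continuousOn fun x hx => by
      simp only [mem_compl_iff, mem_singleton_iff, ofReal_eq_zero]
      exact (ne_of_gt hx)
  exact ((continuous_const.mul continuous_id).continuousOn).mul h1

/-- `p₄` is measurable. [folklore] -/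
theorem measurable_pFour : Measurable pFour := by
  have h := (stronglyMeasurable_hankelDensity (ψ := fun r => besselJ 0 r ^ 4)
    continuous_besselJ_zero_pow_four).measurable
  unfold pFour
  exact ((measurable_const.mul measurable_id).mul (h.comp measurable_ofReal))

/-- **`p₄(x) ≤ K √x`** (from `|f₄(z)| ≤ B‖z‖^{−1/2}`): in particular `p₄` is bounded near `0`.
[folklore] -/
theorem exists_pFour_le_sqrt : ∃ K : ℝ, 0 ≤ K ∧ ∀ x : ℝ, 0 < x → pFour x ≤ K * Real.sqrt x := by
  obtain ⟨C, hC0, hC⟩ := exists_abs_besselJ_zero_le_rpow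
  set B : ℝ := (2 * π)⁻¹ * (C * ∫ r in Ioi (0 : ℝ), |Real.sqrt r * besselJ 0 r ^ 4|) with hB
  have hB0 : 0 ≤ B := by
    have : 0 ≤ ∫ r in Ioi (0 : ℝ), |Real.sqrt r * besselJ 0 r ^ 4| :=
      integral_nonneg fun _ => abs_nonneg _
    positivity
  refine ⟨2 * π * B, by positivity, fun x hx => ?_⟩
  have hz : (x : ℂ) ≠ 0 := by exact_mod_cast hx.ne'
  have h := abs_hankelDensity_le hC integrableOn_sqrt_mul_besselJ_zero_pow_four
    continuous_besselJ_zero_pow_four (fun _ _ => le_rfl) hz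
  rw [← hB, norm_real, Real.norm_of_nonneg hx.le] at h
  have hxr : x * x ^ (-(1 / 2 : ℝ)) = Real.sqrt x := by
    rw [Real.rpow_neg hx.le, ← Real.sqrt_eq_rpow, ← div_eq_mul_inv, Real.div_sqrt]
  calc pFour x ≤ 2 * π * x * |hankelDensity (fun r => besselJ 0 r ^ 4) x| := by
        unfold pFour
        exact mul_le_mul_of_nonneg_left (le_abs_self _) (by positivity)
    _ ≤ 2 * π * x * (B * x ^ (-(1 / 2 : ℝ))) := mul_le_mul_of_nonneg_left h (by positivity)
    _ = 2 * π * B * Real.sqrt x := by rw [← hxr]; ring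

/-- **Transfer of radial integrals**: `∫ g(‖z‖) dS₄(z) = ∫₀^∞ p₄(x) g(x) dx` for continuous `g`.
[cite: BorweinEtAl2012, §2 eq. (2.1)] -/
theorem integral_comp_norm_uniformWalkLaw_four {E : Type*} [NormedAddCommGroup E]
    [NormedSpace ℝ E] {g : ℝ → E} (hg : Continuous g) :
    ∫ z, g ‖z‖ ∂(uniformWalkLaw 4) = ∫ x in Ioi (0 : ℝ), pFour x • g x := by
  have h1 : ∫ z, g ‖z‖ ∂(uniformWalkLaw 4) = ∫ x, g x ∂((uniformWalkLaw 4).map fun z : ℂ => ‖z‖) :=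
    (integral_map continuous_norm.aemeasurable hg.aestronglyMeasurable).symm
  rw [h1, map_norm_uniformWalkLaw_four_eq_pFour,
    integral_withDensity_eq_integral_toReal_smul measurable_pFour.ennreal_ofReal
      (Eventually.of_forall fun _ => ENNReal.ofReal_lt_top)]
  refine setIntegral_congr_fun measurableSet_Ioi fun x hx => ?_
  rw [ENNReal.toReal_ofReal (pFour_nonneg (le_of_lt hx))]

/-- **`p₄` vanishes beyond `4`** (`|S₄| ≤ 4`). [folklore] -/
theorem pFour_eq_zero_of_four_lt {x : ℝ} (hx : 4 < x) : pFour x = 0 := by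
  -- the law of `|S₄|` gives no mass to `(4, ∞)`
  have hnull : (uniformWalkLaw 4).map (fun z : ℂ => ‖z‖) (Ioi 4) = 0 := by
    rw [Measure.map_apply continuous_norm.measurable measurableSet_Ioi]
    have hae := ae_norm_le_uniformWalkLaw 4
    rw [ae_iff] at hae
    have hset : (fun z : ℂ => ‖z‖) ⁻¹' Ioi (4 : ℝ) = {z : ℂ | ¬‖z‖ ≤ ((4 : ℕ) : ℝ)} := by
      ext z
      simp [not_le]
    rw [hset]
    exact hae
  rw [map_norm_uniformWalkLaw_four_eq_pFour, withDensity_apply _ measurableSet_Ioi,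
    Measure.restrict_restrict measurableSet_Ioi, lintegral_eq_zero_iff
      measurable_pFour.ennreal_ofReal] at hnull
  -- so `p₄ = 0` a.e. on `(4, ∞)`, hence everywhere there by continuity
  have hI : Ioi (4 : ℝ) ∩ Ioi 0 = Ioi 4 := by
    ext y; simp only [mem_inter_iff, mem_Ioi]; constructor
    · exact fun h => h.1
    · exact fun h => ⟨h, lt_trans (by norm_num) h⟩
  rw [hI] at hnull
  have hae0 : pFour =ᵐ[volume.restrict (Ioi (4 : ℝ))] 0 := by
    filter_upwards [hnull, ae_restrict_mem measurableSet_Ioi] with y hy hy4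
    have hy4' : (4 : ℝ) < y := hy4
    have hy0 : 0 ≤ pFour y := pFour_nonneg (le_of_lt (lt_trans (by norm_num) hy4'))
    have : ENNReal.ofReal (pFour y) = 0 := hy
    rw [ENNReal.ofReal_eq_zero] at this
    exact le_antisymm this hy0
  have hsub : Ioi (4 : ℝ) ⊆ Ioi 0 := fun y (hy : (4 : ℝ) < y) => lt_trans (by norm_num) hy
  have hEq : EqOn pFour 0 (Ioi (4 : ℝ)) :=
    Measure.eqOn_open_of_ae_eq hae0 isOpen_Ioi (continuousOn_pFour.mono hsub) continuousOn_const
  exact hEq hx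

/-! ### The moment function `W₄` -/

/-- **The moments of the four-step walk** `W₄(s) = ∫₀^∞ x^s p₄(x) dx = E|S₄|^s`, as the Mellin
transform of `p₄` at `s + 1`. [cite: BorweinEtAl2012, §2 (the moments W_n(s))] -/
def W4 (s : ℂ) : ℂ := mellin (fun x : ℝ => (pFour x : ℂ)) (s + 1)

/-- `W₄(s) = ∫₀^∞ x^s p₄(x) dx`. [cite: BorweinEtAl2012, §2] -/
theorem W4_eq (s : ℂ) : W4 s = ∫ x in Ioi (0 : ℝ), (x : ℂ) ^ s * pFour x := by
  simp only [W4, mellin, add_sub_cancel_right, smul_eq_mul]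

/-- `p₄ = O(x^{1/2})` at `0⁺` (as a complex-valued function). [folklore] -/
theorem pFour_isBigO_nhds_zero :
    (fun x : ℝ => (pFour x : ℂ)) =O[𝓝[>] 0] fun x : ℝ => x ^ (-(-(1 / 2 : ℝ))) := by
  obtain ⟨K, -, hK⟩ := exists_pFour_le_sqrt
  refine IsBigO.of_bound K ?_
  filter_upwards [self_mem_nhdsWithin] with x hx
  have hx' : 0 < x := hx
  rw [norm_real, Real.norm_of_nonneg (pFour_nonneg hx'.le), neg_neg,
    Real.norm_of_nonneg (Real.rpow_nonneg hx'.le _), ← Real.sqrt_eq_rpow]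
  exact hK x hx'

/-- `p₄ = O(x^{−a})` at `∞` for every `a` (it vanishes beyond `4`). [folklore] -/
theorem pFour_isBigO_atTop (a : ℝ) :
    (fun x : ℝ => (pFour x : ℂ)) =O[atTop] fun x : ℝ => x ^ (-a) := by
  refine IsBigO.of_bound 0 ?_
  filter_upwards [eventually_gt_atTop (4 : ℝ)] with x hx
  rw [pFour_eq_zero_of_four_lt hx]
  simp

/-- `p₄` is locally integrable on `(0, ∞)`. [folklore] -/
theorem locallyIntegrableOn_pFour :
    LocallyIntegrableOn (fun x : ℝ => (pFour x : ℂ)) (Ioi 0) :=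
  (continuous_ofReal.comp_continuousOn continuousOn_pFour).locallyIntegrableOn measurableSet_Ioi

/-- **`W₄` is holomorphic on `Re s > −3/2`.** [cite: BorweinEtAl2012, §2] -/
theorem differentiableAt_W4 {s : ℂ} (hs : -(3 / 2 : ℝ) < s.re) : DifferentiableAt ℂ W4 s := by
  have h : DifferentiableAt ℂ (mellin fun x : ℝ => (pFour x : ℂ)) (s + 1) := by
    refine mellin_differentiableAt_of_isBigO_rpow (a := s.re + 2) (b := -(1 / 2 : ℝ))
      locallyIntegrableOn_pFour (pFour_isBigO_atTop _) ?_ pFour_isBigO_nhds_zero ?_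
    · simp only [add_re, one_re]; linarith
    · simp only [add_re, one_re]; linarith
  exact h.comp s (differentiableAt_id.add_const 1)

/-- `W₄` is holomorphic on the half-plane `Re s > −3/2`. [cite: BorweinEtAl2012, §2] -/
theorem differentiableOn_W4 : DifferentiableOn ℂ W4 {s : ℂ | -(3 / 2 : ℝ) < s.re} :=
  fun _ hs => (differentiableAt_W4 hs).differentiableWithinAt

/-- Absolute convergence of the Mellin integral for `Re s > −3/2`. [folklore] -/
theorem integrableOn_cpow_mul_pFour {s : ℂ} (hs : -(3 / 2 : ℝ) < s.re) :
    IntegrableOn (fun x : ℝ => (x : ℂ) ^ s * pFour x) (Ioi 0) := by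
  have h := mellinConvergent_of_isBigO_rpow (s := s + 1) (a := s.re + 2) (b := -(1 / 2 : ℝ))
    locallyIntegrableOn_pFour (pFour_isBigO_atTop _) (by simp only [add_re, one_re]; linarith)
    pFour_isBigO_nhds_zero (by simp only [add_re, one_re]; linarith)
  simpa only [MellinConvergent, add_sub_cancel_right, smul_eq_mul] using h

/-- `p₄` is integrable on `(0, ∞)`. [folklore] -/
theorem integrableOn_pFour : IntegrableOn pFour (Ioi 0) := by
  have h := integrableOn_cpow_mul_pFour (s := 0) (by norm_num)
  simp only [cpow_zero, one_mul] at h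
  exact h.re

/-- **Total mass**: `∫₀^∞ p₄ = 1`. [folklore] -/
theorem integral_pFour : ∫ x in Ioi (0 : ℝ), pFour x = 1 := by
  have h := integral_comp_norm_uniformWalkLaw_four (g := fun _ : ℝ => (1 : ℝ)) continuous_const
  simp only [integral_const, smul_eq_mul, mul_one, probReal_univ] at h
  exact h.symm

/-- **The even moments are the Domb numbers**: `W₄(2k) = D_k`.
[cite: BorweinEtAl2012, §2 eq. (Wn-even) and §4 Remark 6] -/
theorem W4_two_mul_natCast (k : ℕ) : W4 (2 * k) = domb k := by
  rw [W4_eq]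
  have h1 : ∫ x in Ioi (0 : ℝ), (x : ℂ) ^ (2 * (k : ℂ)) * pFour x =
      ∫ x in Ioi (0 : ℝ), ((pFour x * x ^ (2 * k) : ℝ) : ℂ) := by
    refine setIntegral_congr_fun measurableSet_Ioi fun x _ => ?_
    rw [show (2 : ℂ) * k = ((2 * k : ℕ) : ℂ) by push_cast; ring, cpow_natCast]
    push_cast; ring
  have h2 : ∫ z, ‖z‖ ^ (2 * k) ∂(uniformWalkLaw 4) = ∫ x in Ioi (0 : ℝ), pFour x * x ^ (2 * k) := by
    have := integral_comp_norm_uniformWalkLaw_four (g := fun x : ℝ => x ^ (2 * k))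
      (continuous_id.pow _)
    simpa only [smul_eq_mul] using this
  have h3 : ∫ z, ‖z‖ ^ (2 * k) ∂(uniformWalkLaw 4) = (domb k : ℝ) := by
    rw [integral_norm_pow_four]
    simp only [domb, threeStepMoment]
    push_cast
    rfl
  rw [h1, integral_complex_ofReal, ← h2, h3]
  push_cast
  rfl

/-- `W₄(0) = 1`. [folklore] -/
theorem W4_zero : W4 0 = 1 := by
  have := W4_two_mul_natCast 0
  simpa [domb_zero] using this

/-- **`|W₄(s)| ≤ 4^{Re s}` for `Re s ≥ 0`** (`|S₄| ≤ 4`). [folklore] -/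
theorem norm_W4_le {s : ℂ} (hs : 0 ≤ s.re) : ‖W4 s‖ ≤ 4 ^ s.re := by
  rw [W4_eq]
  have hint := integrableOn_cpow_mul_pFour (s := s) (by linarith)
  calc ‖∫ x in Ioi (0 : ℝ), (x : ℂ) ^ s * pFour x‖
      ≤ ∫ x in Ioi (0 : ℝ), ‖(x : ℂ) ^ s * pFour x‖ := norm_integral_le_integral_norm _
    _ ≤ ∫ x in Ioi (0 : ℝ), (4 : ℝ) ^ s.re * pFour x := by
        refine setIntegral_mono_on hint.norm (integrableOn_pFour.const_mul _) measurableSet_Ioi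
          fun x hx => ?_
        have hx' : 0 < x := hx
        rw [norm_mul, norm_cpow_eq_rpow_re_of_pos hx', norm_real,
          Real.norm_of_nonneg (pFour_nonneg hx'.le)]
        rcases le_or_gt x 4 with h4 | h4
        · exact mul_le_mul_of_nonneg_right (Real.rpow_le_rpow hx'.le h4 hs) (pFour_nonneg hx'.le)
        · rw [pFour_eq_zero_of_four_lt h4]; simp
    _ = (4 : ℝ) ^ s.re := by rw [integral_const_mul, integral_pFour, mul_one]

/-! ### The functional equation -/

/-- The functional-equation expression `(s+4)³W₄(s+4) − 4(s+3)(5s²+30s+48)W₄(s+2) + 64(s+2)³W₄(s)`.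
[cite: BorweinEtAl2012, §2 Example 1] -/
def W4FE (s : ℂ) : ℂ :=
  (s + 4) ^ 3 * W4 (s + 4) - 4 * (s + 3) * (5 * s ^ 2 + 30 * s + 48) * W4 (s + 2) +
    64 * (s + 2) ^ 3 * W4 s

/-- `W4FE` is holomorphic on `Re s > −3/2`. [folklore] -/
theorem differentiableAt_W4FE {s : ℂ} (hs : -(3 / 2 : ℝ) < s.re) : DifferentiableAt ℂ W4FE s := by
  have h4 : DifferentiableAt ℂ (fun s => W4 (s + 4)) s :=
    (differentiableAt_W4 (by simp only [add_re]; norm_num; linarith)).comp s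
      (differentiableAt_id.add_const 4)
  have h2 : DifferentiableAt ℂ (fun s => W4 (s + 2)) s :=
    (differentiableAt_W4 (by simp only [add_re]; norm_num; linarith)).comp s
      (differentiableAt_id.add_const 2)
  have h0 : DifferentiableAt ℂ W4 s := differentiableAt_W4 hs
  unfold W4FE
  fun_prop

/-- **At the even integers the functional equation is `8×` the Domb recurrence**:
`W4FE (2k) = 0`. [cite: BorweinEtAl2012, §2 Example 1; §4 Remark 6] -/
theorem W4FE_two_mul_natCast (k : ℕ) : W4FE (2 * k) = 0 := by
  have e4 : W4 (2 * (k : ℂ) + 4) = domb (k + 1 + 1) := by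
    rw [show 2 * (k : ℂ) + 4 = 2 * ((k + 1 + 1 : ℕ) : ℂ) by push_cast; ring, W4_two_mul_natCast]
  have e2 : W4 (2 * (k : ℂ) + 2) = domb (k + 1) := by
    rw [show 2 * (k : ℂ) + 2 = 2 * ((k + 1 : ℕ) : ℂ) by push_cast; ring, W4_two_mul_natCast]
  have e0 : W4 (2 * (k : ℂ)) = domb k := W4_two_mul_natCast k
  have hrec := domb_recurrence (k := k + 1) (by omega)
  rw [Nat.add_sub_cancel] at hrec
  have hrecC : ((k : ℂ) + 1 + 1) ^ 3 * (domb (k + 1 + 1) : ℂ) + 64 * ((k : ℂ) + 1) ^ 3 * (domb k : ℂ)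
      = 2 * (2 * ((k : ℂ) + 1) + 1) * (5 * ((k : ℂ) + 1) ^ 2 + 5 * ((k : ℂ) + 1) + 2) *
          (domb (k + 1) : ℂ) := by
    exact_mod_cast hrec
  unfold W4FE
  rw [e4, e2, e0]
  linear_combination (8 : ℂ) * hrecC

/-- The Carlson function `u ↦ 4^{−(2u+4)} (u+1)^{−3} · W4FE(2u)`: holomorphic on `Re u > −3/4`,
bounded on `Re u ≥ 0`, zero at the naturals. [folklore] -/
def carlsonFun (u : ℂ) : ℂ :=
  cexp (-(2 * u + 4) * Real.log 4) * ((u + 1) ^ 3)⁻¹ * W4FE (2 * u)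

/-- `‖exp(−(2u+4) log 4)‖ = 4^{−(2 Re u + 4)}`. [folklore] -/
theorem norm_cexp_neg_log_four (u : ℂ) :
    ‖cexp (-(2 * u + 4) * Real.log 4)‖ = (4 : ℝ) ^ (-(2 * u.re + 4)) := by
  have h2 : (-(2 * u + 4) : ℂ).re = -(2 * u.re + 4) := by simp
  rw [norm_exp, re_mul_ofReal, h2, Real.rpow_def_of_pos (by norm_num : (0 : ℝ) < 4)]
  congr 1
  ring

/-- **Boundedness on the closed right half-plane**: `‖carlsonFun u‖ ≤ 102` for `Re u ≥ 0`.
[folklore] -/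
theorem norm_carlsonFun_le {u : ℂ} (hu : 0 ≤ u.re) : ‖carlsonFun u‖ ≤ 102 := by
  have hw1 : 1 ≤ ‖u + 1‖ := by
    calc (1 : ℝ) ≤ |(u + 1).re| := by
          rw [add_re, one_re]; exact le_trans (by linarith) (le_abs_self _)
      _ ≤ ‖u + 1‖ := abs_re_le_norm _
  have hw0 : 0 < ‖u + 1‖ := lt_of_lt_of_le one_pos hw1
  have hwsq : ‖u + 1‖ ≤ ‖u + 1‖ ^ 2 := by nlinarith
  have hwsq1 : 1 ≤ ‖u + 1‖ ^ 2 := by nlinarith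
  have h4pos : (0 : ℝ) < 4 := by norm_num
  -- the three `W₄` values
  have hW4 : ‖W4 (2 * u + 4)‖ ≤ (4 : ℝ) ^ (2 * u.re + 4) := by
    have h := norm_W4_le (s := 2 * u + 4) (by simp; linarith)
    have hre : (2 * u + 4 : ℂ).re = 2 * u.re + 4 := by simp
    rwa [hre] at h
  have hW2 : ‖W4 (2 * u + 2)‖ ≤ (4 : ℝ) ^ (2 * u.re + 2) := by
    have h := norm_W4_le (s := 2 * u + 2) (by simp; linarith)
    have hre : (2 * u + 2 : ℂ).re = 2 * u.re + 2 := by simp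
    rwa [hre] at h
  have hW0 : ‖W4 (2 * u)‖ ≤ (4 : ℝ) ^ (2 * u.re) := by
    have h := norm_W4_le (s := 2 * u) (by simp; linarith)
    have hre : (2 * u : ℂ).re = 2 * u.re := by simp
    rwa [hre] at h
  -- polynomial factors in terms of `u + 1`
  have hp4 : ‖2 * u + 4‖ ≤ 4 * ‖u + 1‖ := by
    calc ‖2 * u + 4‖ = ‖2 * (u + 1) + 2‖ := by congr 1; ring
      _ ≤ ‖2 * (u + 1)‖ + ‖(2 : ℂ)‖ := norm_add_le _ _
      _ = 2 * ‖u + 1‖ + 2 := by rw [norm_mul]; simp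
      _ ≤ 4 * ‖u + 1‖ := by linarith
  have hp3 : ‖2 * u + 3‖ ≤ 3 * ‖u + 1‖ := by
    calc ‖2 * u + 3‖ = ‖2 * (u + 1) + 1‖ := by congr 1; ring
      _ ≤ ‖2 * (u + 1)‖ + ‖(1 : ℂ)‖ := norm_add_le _ _
      _ = 2 * ‖u + 1‖ + 1 := by rw [norm_mul]; simp
      _ ≤ 3 * ‖u + 1‖ := by linarith
  have hpq : ‖20 * u ^ 2 + 60 * u + 48‖ ≤ 48 * ‖u + 1‖ ^ 2 := by
    calc ‖20 * u ^ 2 + 60 * u + 48‖ = ‖20 * (u + 1) ^ 2 + 20 * (u + 1) + 8‖ := by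
          congr 1; ring
      _ ≤ ‖20 * (u + 1) ^ 2 + 20 * (u + 1)‖ + ‖(8 : ℂ)‖ := norm_add_le _ _
      _ ≤ ‖20 * (u + 1) ^ 2‖ + ‖20 * (u + 1)‖ + ‖(8 : ℂ)‖ := by
          gcongr; exact norm_add_le _ _
      _ = 20 * ‖u + 1‖ ^ 2 + 20 * ‖u + 1‖ + 8 := by
          rw [norm_mul, norm_mul, norm_pow]; simp
      _ ≤ 48 * ‖u + 1‖ ^ 2 := by linarith
  have hp2 : ‖2 * u + 2‖ = 2 * ‖u + 1‖ := by
    rw [show 2 * u + 2 = 2 * (u + 1) by ring, norm_mul]; simp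
  -- powers of `4`
  have e44 : (4 : ℝ) ^ (-(2 * u.re + 4)) * (4 : ℝ) ^ (2 * u.re + 4) = 1 := by
    rw [← Real.rpow_add h4pos]; simp
  have h42 : (4 : ℝ) ^ (2 : ℝ) = 16 := by rw [Real.rpow_two]; norm_num
  have h44 : (4 : ℝ) ^ (4 : ℝ) = 256 := by
    rw [show (4 : ℝ) = ((4 : ℕ) : ℝ) by norm_num, Real.rpow_natCast]; norm_num
  have e42 : (4 : ℝ) ^ (-(2 * u.re + 4)) * (4 : ℝ) ^ (2 * u.re + 2) = 1 / 16 := by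
    rw [← Real.rpow_add h4pos, show -(2 * u.re + 4) + (2 * u.re + 2) = -(2 : ℝ) by ring,
      Real.rpow_neg h4pos.le, h42, one_div]
  have e40 : (4 : ℝ) ^ (-(2 * u.re + 4)) * (4 : ℝ) ^ (2 * u.re) = 1 / 256 := by
    rw [← Real.rpow_add h4pos, show -(2 * u.re + 4) + 2 * u.re = -(4 : ℝ) by ring,
      Real.rpow_neg h4pos.le, h44, one_div]
  have hexp : ‖cexp (-(2 * u + 4) * Real.log 4)‖ = (4 : ℝ) ^ (-(2 * u.re + 4)) :=
    norm_cexp_neg_log_four u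
  have hinv : ‖((u + 1) ^ 3)⁻¹‖ = (‖u + 1‖ ^ 3)⁻¹ := by rw [norm_inv, norm_pow]
  -- the three terms of the bracket
  have hT1 : ‖(2 * u + 4) ^ 3 * W4 (2 * u + 4)‖ ≤ 64 * ‖u + 1‖ ^ 3 * (4 : ℝ) ^ (2 * u.re + 4) := by
    rw [norm_mul, norm_pow]
    calc ‖2 * u + 4‖ ^ 3 * ‖W4 (2 * u + 4)‖ ≤ (4 * ‖u + 1‖) ^ 3 * (4 : ℝ) ^ (2 * u.re + 4) :=
          mul_le_mul (pow_le_pow_left₀ (norm_nonneg _) hp4 3) hW4 (norm_nonneg _) (by positivity)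
      _ = 64 * ‖u + 1‖ ^ 3 * (4 : ℝ) ^ (2 * u.re + 4) := by ring
  have hT2 : ‖4 * (2 * u + 3) * (5 * (2 * u) ^ 2 + 30 * (2 * u) + 48) * W4 (2 * u + 2)‖ ≤
      576 * ‖u + 1‖ ^ 3 * (4 : ℝ) ^ (2 * u.re + 2) := by
    have hq : 5 * (2 * u) ^ 2 + 30 * (2 * u) + 48 = 20 * u ^ 2 + 60 * u + 48 := by ring
    rw [hq, norm_mul, norm_mul, norm_mul]
    have h4 : ‖(4 : ℂ)‖ = 4 := by simp
    rw [h4]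
    calc 4 * ‖2 * u + 3‖ * ‖20 * u ^ 2 + 60 * u + 48‖ * ‖W4 (2 * u + 2)‖
        ≤ 4 * (3 * ‖u + 1‖) * (48 * ‖u + 1‖ ^ 2) * (4 : ℝ) ^ (2 * u.re + 2) :=
          mul_le_mul (mul_le_mul (mul_le_mul_of_nonneg_left hp3 (by norm_num)) hpq
            (norm_nonneg _) (by positivity)) hW2 (norm_nonneg _) (by positivity)
      _ = 576 * ‖u + 1‖ ^ 3 * (4 : ℝ) ^ (2 * u.re + 2) := by ring
  have hT3 : ‖64 * (2 * u + 2) ^ 3 * W4 (2 * u)‖ ≤ 512 * ‖u + 1‖ ^ 3 * (4 : ℝ) ^ (2 * u.re) := by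
    rw [norm_mul, norm_mul, norm_pow, hp2]
    have h64 : ‖(64 : ℂ)‖ = 64 := by simp
    rw [h64]
    calc 64 * (2 * ‖u + 1‖) ^ 3 * ‖W4 (2 * u)‖ ≤ 64 * (2 * ‖u + 1‖) ^ 3 * (4 : ℝ) ^ (2 * u.re) :=
          mul_le_mul_of_nonneg_left hW0 (by positivity)
      _ = 512 * ‖u + 1‖ ^ 3 * (4 : ℝ) ^ (2 * u.re) := by ring
  have hbr : ‖(2 * u + 4) ^ 3 * W4 (2 * u + 4) -
        4 * (2 * u + 3) * (5 * (2 * u) ^ 2 + 30 * (2 * u) + 48) * W4 (2 * u + 2) +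
        64 * (2 * u + 2) ^ 3 * W4 (2 * u)‖ ≤
      64 * ‖u + 1‖ ^ 3 * (4 : ℝ) ^ (2 * u.re + 4) + 576 * ‖u + 1‖ ^ 3 * (4 : ℝ) ^ (2 * u.re + 2) +
        512 * ‖u + 1‖ ^ 3 * (4 : ℝ) ^ (2 * u.re) := by
    have t1 := norm_add_le ((2 * u + 4) ^ 3 * W4 (2 * u + 4) -
        4 * (2 * u + 3) * (5 * (2 * u) ^ 2 + 30 * (2 * u) + 48) * W4 (2 * u + 2))
      (64 * (2 * u + 2) ^ 3 * W4 (2 * u))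
    have t2 := norm_sub_le ((2 * u + 4) ^ 3 * W4 (2 * u + 4))
      (4 * (2 * u + 3) * (5 * (2 * u) ^ 2 + 30 * (2 * u) + 48) * W4 (2 * u + 2))
    linarith
  unfold carlsonFun W4FE
  rw [norm_mul, norm_mul, hexp, hinv]
  have hw3 : (0 : ℝ) < ‖u + 1‖ ^ 3 := by positivity
  calc (4 : ℝ) ^ (-(2 * u.re + 4)) * (‖u + 1‖ ^ 3)⁻¹ *
        ‖(2 * u + 4) ^ 3 * W4 (2 * u + 4) -
          4 * (2 * u + 3) * (5 * (2 * u) ^ 2 + 30 * (2 * u) + 48) * W4 (2 * u + 2) +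
          64 * (2 * u + 2) ^ 3 * W4 (2 * u)‖
      ≤ (4 : ℝ) ^ (-(2 * u.re + 4)) * (‖u + 1‖ ^ 3)⁻¹ *
          (64 * ‖u + 1‖ ^ 3 * (4 : ℝ) ^ (2 * u.re + 4) +
            576 * ‖u + 1‖ ^ 3 * (4 : ℝ) ^ (2 * u.re + 2) +
            512 * ‖u + 1‖ ^ 3 * (4 : ℝ) ^ (2 * u.re)) :=
        mul_le_mul_of_nonneg_left hbr (by positivity)
    _ = 64 * ((4 : ℝ) ^ (-(2 * u.re + 4)) * (4 : ℝ) ^ (2 * u.re + 4)) +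
          576 * ((4 : ℝ) ^ (-(2 * u.re + 4)) * (4 : ℝ) ^ (2 * u.re + 2)) +
          512 * ((4 : ℝ) ^ (-(2 * u.re + 4)) * (4 : ℝ) ^ (2 * u.re)) := by
        field_simp
    _ = 102 := by rw [e44, e42, e40]; norm_num

/-- `carlsonFun` is holomorphic on `Re u > −3/4` (an open set containing `Re u ≥ 0`).
[folklore] -/
theorem differentiableOn_carlsonFun :
    DifferentiableOn ℂ carlsonFun {u : ℂ | -(3 / 4 : ℝ) < u.re} := by
  intro u hu
  have hu' : -(3 / 4 : ℝ) < u.re := hu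
  have hFE : DifferentiableAt ℂ (fun u : ℂ => W4FE (2 * u)) u :=
    (differentiableAt_W4FE (by simp; linarith)).comp u (differentiableAt_id.const_mul _)
  have hne : (u + 1) ^ 3 ≠ 0 := by
    apply pow_ne_zero
    intro h
    have := congrArg Complex.re h
    simp at this
    linarith
  have hinv : DifferentiableAt ℂ (fun u : ℂ => ((u + 1) ^ 3)⁻¹) u :=
    ((differentiableAt_id.add_const 1).pow 3).inv hne
  have hexp : DifferentiableAt ℂ (fun u : ℂ => cexp (-(2 * u + 4) * Real.log 4)) u := by
    fun_prop
  exact ((hexp.mul hinv).mul hFE).differentiableWithinAt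

/-- `carlsonFun` vanishes at the naturals. [folklore] -/
theorem carlsonFun_natCast (n : ℕ) : carlsonFun n = 0 := by
  unfold carlsonFun
  rw [W4FE_two_mul_natCast, mul_zero]

/-- **The functional equation on `Re s ≥ 0`** by Carlson's theorem. [cite: BorweinEtAl2012, §2 Example 1] -/
theorem W4FE_eq_zero_of_re_nonneg {s : ℂ} (hs : 0 ≤ s.re) : W4FE s = 0 := by
  have hC := AndrewsAskeyRoy1999_thm_2_8_1_holds carlsonFun
    ⟨{u : ℂ | -(3 / 4 : ℝ) < u.re}, isOpen_lt continuous_const continuous_re,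
      fun u (hu : 0 ≤ u.re) => show -(3 / 4 : ℝ) < u.re by linarith,
      differentiableOn_carlsonFun⟩
    ⟨102, fun u hu => norm_carlsonFun_le hu⟩ carlsonFun_natCast (s / 2)
    (by simp only [div_ofNat_re]; linarith)
  unfold carlsonFun at hC
  rw [show 2 * (s / 2) = s by ring] at hC
  rcases mul_eq_zero.mp hC with h | h
  · rcases mul_eq_zero.mp h with h' | h'
    · exact absurd h' (exp_ne_zero _)
    · exfalso
      rw [inv_eq_zero] at h'
      have hne : (s / 2 + 1) ^ 3 ≠ 0 := by
        apply pow_ne_zero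
        intro h0
        have := congrArg Complex.re h0
        simp at this
        linarith
      exact hne h'
  · exact h

/-- **The functional equation of `W₄`** [BorweinEtAl2012, §2 Example 1]: for `Re s > −3/2`,
`(s+4)³ W₄(s+4) − 4(s+3)(5s²+30s+48) W₄(s+2) + 64(s+2)³ W₄(s) = 0`,
"coming from the inevitable recursion" of the even moments (the Domb recurrence) via Carlson's
theorem, and extended to the half-plane of holomorphy by the identity theorem.
[cite: BorweinEtAl2012, §2 Example 1 (functional equation of W₄)] -/
theorem W4_functionalEquation {s : ℂ} (hs : -(3 / 2 : ℝ) < s.re) :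
    (s + 4) ^ 3 * W4 (s + 4) - 4 * (s + 3) * (5 * s ^ 2 + 30 * s + 48) * W4 (s + 2) +
      64 * (s + 2) ^ 3 * W4 s = 0 := by
  have hDo : DifferentiableOn ℂ W4FE {s : ℂ | -(3 / 2 : ℝ) < s.re} :=
    fun s hs => (differentiableAt_W4FE hs).differentiableWithinAt
  have hD : AnalyticOnNhd ℂ W4FE {s : ℂ | -(3 / 2 : ℝ) < s.re} :=
    hDo.analyticOnNhd (isOpen_lt continuous_const continuous_re)
  have hev : W4FE =ᶠ[𝓝 (1 : ℂ)] 0 := by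
    have hmem : {s : ℂ | 0 < s.re} ∈ 𝓝 (1 : ℂ) :=
      (isOpen_lt continuous_const continuous_re).mem_nhds (by simp)
    filter_upwards [hmem] with s hs
    exact W4FE_eq_zero_of_re_nonneg (le_of_lt hs)
  have hEq := hD.eqOn_zero_of_preconnected_of_eventuallyEq_zero
    (convex_halfSpace_re_gt _).isPreconnected (by simp; norm_num) hev
  exact hEq hs

end Literature.Analysis.FunctionSpaces

end
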